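/-
Copyright (c) 2026 the pub-hodgecm-mathlib formalisation cell (harness21).  Prover seat hodgecm-mathlib-F0P3b-p01 (g11), 2026-09-01.  Road «S3-tree» (census «S3» v3, architect
A-p16 (g29)), brick T3′ «depth-zero κ-transfer» ∕ T4′(b) «level shift»: organ «CAYLEY SHIFT» — the shifted order `O[(γ−1)∕c]` is generated by the UNITARY Cayley transform
`Y = (1 + z∕c)(1 − z∕c)⁻¹`, `z = (γ−1)(γ+1)⁻¹`, with root valuations divided by `|c|` (holder's CAYLEY NOTE, DESIGN v2 §2 (P-1) `n₀`; F0P2-p01 (g13)'s «ORDER-STABILITY» hypotheses).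
-/
import Literature.NumberTheory.Automorphic.SplitTorusOrderEigenframe        -- ★ O8a-3 (this seat): `conj_diagonal_pow` (brings ★ O7∕O6: `one∕mul∕pow∕inv_mem_span_pow`, `HeckeTransversalGL` valuation currency)
import Mathlib.RingTheory.Adjoin.Polynomial.Basic
import HarnessLib

/-!
# The Cayley shift: `O[c⁻¹(γ−1)] = O[c⁻¹z] = O[Y]`, `Y = (1 + c⁻¹z)(1 − c⁻¹z)⁻¹` unitary, `|Y_i − Y_j| = |γ_i − γ_j| ∕ |c|`

Topic `NumberTheory/Automorphic`; namespace `Literature.NumberTheory.Automorphic`.  THEOREMS ONLY (no definition, no instance, no notation, no named fact, no `sorry`); §1–§3 over any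
field `K` with a subring `O ∋ 2⁻¹` and any ring endomorphism `σ` fixing `c`; §4 in the `[ValuativeRel F]` currency; §5 the matrix bridge to `Algebra.adjoin O {P·diag·P⁻¹}`.  Cell
`pub/hodgecm-mathlib`, crux H413 = `stmt-HodgeConjecture-24833`; road «S3-tree», bricks T3′ (row `ψ₀ = 1_{K(1)}`: `n₀(γ) = N_0(Y)`) and T4′(b) (★ C1 `UnitaryLatticeTreeLevelShift` + F0P2-p01's
«ORDER-STABILITY», whose hypotheses `↑u ∈ adjoin {X}`, `↑u⁻¹ ∈ adjoin {X}`, `X ∈ adjoin {↑u}` are §1–§2 + §5 here).  HONEST LABEL: HC_CM is proved only modulo the cell's 2 remaining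
named inputs (hLiu418, h413) until rung 0 closes; elementary algebra, asserts nothing printed.

THE MATHEMATICS (eigen-coordinates of the split torus).  `γ : Fin n → K` (eigenvalues, norm one: `σ(γ_i)γ_i = 1`), `c ∈ O` (`= ϖ^j`), and
`z_i := (γ_i − 1)(γ_i + 1)⁻¹` (the Cayley parameter, SKEW: `σ z_i = −z_i`), `X_i := c⁻¹(γ_i − 1)`, `Z_i := c⁻¹ z_i`, `Y_i := (1 + Z_i)(1 − Z_i)⁻¹` (the inverse Cayley transform of the
shifted skew element).  With `R_T := span_O {(T_i^k)_i : k < n}` (★ O6∕O7's order token):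
* §1 `span_pow_le_span_pow_of_mem` (`x ∈ R_y ⇒ R_x ≤ R_y`); **`span_pow_shift_eq_span_pow_cayleyParam`** `R_X = R_Z` (needs `X_i ∈ O`, `γ_i ∈ O`, `γ_i + 1 ∈ O^×`, `2⁻¹ ∈ O`);
* §2 **`span_pow_cayleyParam_eq_span_pow_cayley`** `R_Z = R_Y` and `cayley_inv_mem_span_pow` (`Y⁻¹ ∈ R_Y`) (needs `Z_i ∈ O`, `1 ± Z_i ∈ O^×`, `2⁻¹ ∈ O`) — so `Y^{±1} ∈ O[X]`, `X ∈ O[Y]`;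
* §3 `map_cayleyParam_eq_neg` (`σ z = −z`), **`map_cayley_mul_cayley`** (`σ(Y_i)·Y_i = 1`: `Y` is UNITARY in the same eigenframe);
* §4 `cayley_sub_cayley` and **`valuation_cayley_sub_cayley`**: `|Y_i − Y_j| = |γ_i − γ_j| ∕ |c|` — every root valuation of `γ` is lowered by `ord c = j`;
* §5 **`conj_diagonal_mem_adjoin_of_mem_span_pow`**: `y ∈ R_x ⇒ P·diag(y)·P⁻¹ ∈ Algebra.adjoin O {P·diag(x)·P⁻¹}` (the matrix reading F0P2-p01's ORDER-STABILITY consumes).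
Hence `N_j(γ) = #{self-dual M : (γ−1)M ≤ ϖ^jM} = #{M : O[X]·M ≤ M} = #{M : Y·M = M} = N_0(Y)` with `Y ∈ T(F)` of the same class type and valuations `N_{ik} − j` — the level-1
stratum of T3′ is the ★ Flicker value at the shifted exponents.

## References
* [SerreLocalFields1979] J.-P. Serre, *Local Fields* (1979), Ch. III §6 (orders), Ch. V §3 (the filtration `U^{(j)}` and `(1+x)(1−x)⁻¹`).
* [Weil1964] A. Weil, *Sur certains groupes d'opérateurs unitaires*, Acta Math. 111 (1964), §29 (the Cayley transform of skew elements into the unitary group).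
* [Rogawski1990] J. D. Rogawski, *Automorphic Representations of Unitary Groups in Three Variables* (1990), §4.9 p. 54 (level structure of the fixed-vertex counts).
-/

set_option autoImplicit false

open Polynomial Finset Matrix

namespace Literature.NumberTheory.Automorphic

section Algebra

variable {K : Type*} [Field K] {n : ℕ} (O : Subring K)

/-! ## §1 `R_X = R_Z`: the shifted element and the shifted Cayley parameter generate the same order -/

/-- `x ∈ R_y ⇒ R_x ≤ R_y` (powers of an element of the order stay in the order). [cite: SerreLocalFields1979, Ch. III §6] -/
theorem span_pow_le_span_pow_of_mem {x y : Fin n → K} (hy : ∀ i, y i ∈ O)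
    (hx : x ∈ Submodule.span O (Set.range fun j : Fin n => fun i => y i ^ (j : ℕ))) :
    Submodule.span O (Set.range fun j : Fin n => fun i => x i ^ (j : ℕ)) ≤ Submodule.span O (Set.range fun j : Fin n => fun i => y i ^ (j : ℕ)) := by
  rw [Submodule.span_le]
  rintro _ ⟨j, rfl⟩
  exact pow_mem_span_pow O hy hx j

/-- A unit hypothesis `∃ y ∈ O, y * t = 1` makes `t ≠ 0` and `t⁻¹ ∈ O`. [cite: SerreLocalFields1979, Ch. III §6] -/
theorem ne_zero_and_inv_mem_of_exists_mul_eq_one {t : K} (h : ∃ y ∈ O, y * t = 1) : t ≠ 0 ∧ t⁻¹ ∈ O := by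
  obtain ⟨y, hy, hyt⟩ := h
  have ht : t ≠ 0 := fun h0 => by rw [h0, mul_zero] at hyt; exact zero_ne_one hyt
  exact ⟨ht, by rwa [← eq_inv_of_mul_eq_one_left hyt]⟩

/-- **`R_X = R_Z`** for `X_i = c⁻¹(γ_i − 1)`, `Z_i = c⁻¹(γ_i − 1)(γ_i + 1)⁻¹`: the shifted element and the shifted Cayley parameter generate the same order
(`Z = X·(γ+1)⁻¹`, `γ + 1 = 2 + cX ∈ O[X]^×`; `X = Z·(γ+1)`, `γ + 1 = 2(1 − cZ)⁻¹ ∈ O[Z]^×`). [cite: SerreLocalFields1979, Ch. V §3] [cite: Weil1964, §29] -/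
theorem span_pow_shift_eq_span_pow_cayleyParam {γ : Fin n → K} {c : K} (hc : c ∈ O) (hc0 : c ≠ 0) (h20 : (2 : K) ≠ 0) (h2 : (2 : K)⁻¹ ∈ O)
    (hγ : ∀ i, γ i ∈ O) (hX : ∀ i, c⁻¹ * (γ i - 1) ∈ O) (hγ1 : ∀ i, ∃ y ∈ O, y * (γ i + 1) = 1) :
    Submodule.span O (Set.range fun j : Fin n => fun i => (c⁻¹ * (γ i - 1)) ^ (j : ℕ)) =
      Submodule.span O (Set.range fun j : Fin n => fun i => (c⁻¹ * ((γ i - 1) / (γ i + 1))) ^ (j : ℕ)) := by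
  have hγ1' : ∀ i, γ i + 1 ≠ 0 ∧ (γ i + 1)⁻¹ ∈ O := fun i => ne_zero_and_inv_mem_of_exists_mul_eq_one O (hγ1 i)
  have hZ : ∀ i, c⁻¹ * ((γ i - 1) / (γ i + 1)) ∈ O := fun i => by
    rw [div_eq_mul_inv, ← mul_assoc]; exact Subring.mul_mem _ (hX i) (hγ1' i).2
  -- `X ∈ R_X`, `Z ∈ R_Z` (the `j = 1` generator, or `n = 0`∕`n = 1` bookkeeping via polynomials)
  have hXmem : (fun i => c⁻¹ * (γ i - 1)) ∈ Submodule.span O (Set.range fun j : Fin n => fun i => (c⁻¹ * (γ i - 1)) ^ (j : ℕ)) := by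
    have h := eval_mem_span_pow O hX (γ := fun i => c⁻¹ * (γ i - 1)) Polynomial.X
    simp only [Polynomial.map_X, Polynomial.eval_X] at h
    exact h
  have hZmem : (fun i => c⁻¹ * ((γ i - 1) / (γ i + 1))) ∈
      Submodule.span O (Set.range fun j : Fin n => fun i => (c⁻¹ * ((γ i - 1) / (γ i + 1))) ^ (j : ℕ)) := by
    have h := eval_mem_span_pow O hZ (γ := fun i => c⁻¹ * ((γ i - 1) / (γ i + 1))) Polynomial.X
    simp only [Polynomial.map_X, Polynomial.eval_X] at h
    exact h
  apply le_antisymm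
  · -- `X = Z · (γ + 1)` with `γ + 1 = 2 · (1 − cZ)⁻¹ ∈ R_Z`
    refine span_pow_le_span_pow_of_mem O hZ ?_
    have h1 : (1 : Fin n → K) ∈ Submodule.span O (Set.range fun j : Fin n => fun i => (c⁻¹ * ((γ i - 1) / (γ i + 1))) ^ (j : ℕ)) :=
      one_mem_span_pow O hZ
    have hw : (fun i => 1 - c * (c⁻¹ * ((γ i - 1) / (γ i + 1)))) ∈
        Submodule.span O (Set.range fun j : Fin n => fun i => (c⁻¹ * ((γ i - 1) / (γ i + 1))) ^ (j : ℕ)) := by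
      have : (fun i => 1 - c * (c⁻¹ * ((γ i - 1) / (γ i + 1)))) = (1 : Fin n → K) - (⟨c, hc⟩ : O) • (fun i => c⁻¹ * ((γ i - 1) / (γ i + 1))) := by
        funext i; simp [Subring.smul_def]
      rw [this]
      exact Submodule.sub_mem _ h1 (Submodule.smul_mem _ _ hZmem)
    -- `1 − cZ_i = 2 (γ_i+1)⁻¹` is a unit of `O`
    have hwval : ∀ i, 1 - c * (c⁻¹ * ((γ i - 1) / (γ i + 1))) = 2 * (γ i + 1)⁻¹ := fun i => by
      field_simp [(hγ1' i).1, hc0]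
      ring
    have hwu : ∀ i, ∃ y ∈ O, y * (1 - c * (c⁻¹ * ((γ i - 1) / (γ i + 1)))) = 1 := fun i =>
      ⟨(2 : K)⁻¹ * (γ i + 1), Subring.mul_mem _ h2 (Subring.add_mem _ (hγ i) (Subring.one_mem _)), by
        rw [hwval i]; field_simp [(hγ1' i).1, h20]⟩
    have hwinv := inv_mem_span_pow O hZ hw hwu
    -- `X = Z * (2 * w⁻¹)`
    have hXeq : (fun i => c⁻¹ * (γ i - 1)) =
        (fun i => c⁻¹ * ((γ i - 1) / (γ i + 1))) * ((⟨2, (by rw [show (2 : K) = 1 + 1 from by norm_num]; exact Subring.add_mem _ (Subring.one_mem O) (Subring.one_mem O))⟩ : O) •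
          (fun i => 1 - c * (c⁻¹ * ((γ i - 1) / (γ i + 1))))⁻¹) := by
      funext i
      simp only [Pi.mul_apply, Pi.smul_apply, Pi.inv_apply, Subring.smul_def, smul_eq_mul, hwval i]
      field_simp [(hγ1' i).1, h20]
    rw [hXeq]
    exact mul_mem_span_pow O hZ hZmem (Submodule.smul_mem _ _ hwinv)
  · -- `Z = X · (γ + 1)⁻¹` with `γ + 1 = 2 + cX ∈ R_X`
    refine span_pow_le_span_pow_of_mem O hX ?_
    have h1 : (1 : Fin n → K) ∈ Submodule.span O (Set.range fun j : Fin n => fun i => (c⁻¹ * (γ i - 1)) ^ (j : ℕ)) := one_mem_span_pow O hX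
    have hg1 : (fun i => γ i + 1) ∈ Submodule.span O (Set.range fun j : Fin n => fun i => (c⁻¹ * (γ i - 1)) ^ (j : ℕ)) := by
      have : (fun i => γ i + 1) = (⟨2, (by rw [show (2 : K) = 1 + 1 from by norm_num]; exact Subring.add_mem _ (Subring.one_mem O) (Subring.one_mem O))⟩ : O) • (1 : Fin n → K) +
          (⟨c, hc⟩ : O) • (fun i => c⁻¹ * (γ i - 1)) := by
        funext i
        simp only [Pi.add_apply, Pi.smul_apply, Pi.one_apply, Subring.smul_def, smul_eq_mul]
        field_simp [hc0]
        ring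
      rw [this]
      exact Submodule.add_mem _ (Submodule.smul_mem _ _ h1) (Submodule.smul_mem _ _ hXmem)
    have hginv := inv_mem_span_pow O hX hg1 hγ1
    have hZeq : (fun i => c⁻¹ * ((γ i - 1) / (γ i + 1))) = (fun i => c⁻¹ * (γ i - 1)) * (fun i => γ i + 1)⁻¹ := by
      funext i
      simp only [Pi.mul_apply, Pi.inv_apply]
      rw [div_eq_mul_inv, mul_assoc]
    rw [hZeq]
    exact mul_mem_span_pow O hX hXmem hginv

/-! ## §2 `R_Z = R_Y`: the Cayley transform `Y = (1+Z)(1−Z)⁻¹` generates the same order, and `Y⁻¹ ∈ R_Y` -/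

/-- **`R_Z = R_Y`** for `Y_i = (1 + Z_i)(1 − Z_i)⁻¹` when `1 ± Z_i` are units of `O` and `2⁻¹ ∈ O` (`Y = (1+Z)(1−Z)⁻¹ ∈ R_Z`; `Z = (Y−1)(Y+1)⁻¹`, `Y + 1 = 2(1−Z)⁻¹ ∈ R_Y^×`).
[cite: Weil1964, §29] [cite: SerreLocalFields1979, Ch. V §3] -/
theorem span_pow_cayleyParam_eq_span_pow_cayley {Z : Fin n → K} (h20 : (2 : K) ≠ 0) (h2 : (2 : K)⁻¹ ∈ O) (hZ : ∀ i, Z i ∈ O)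
    (hm : ∀ i, ∃ y ∈ O, y * (1 - Z i) = 1) (hp : ∀ i, ∃ y ∈ O, y * (1 + Z i) = 1) :
    Submodule.span O (Set.range fun j : Fin n => fun i => Z i ^ (j : ℕ)) =
      Submodule.span O (Set.range fun j : Fin n => fun i => ((1 + Z i) / (1 - Z i)) ^ (j : ℕ)) := by
  have hm' : ∀ i, 1 - Z i ≠ 0 ∧ (1 - Z i)⁻¹ ∈ O := fun i => ne_zero_and_inv_mem_of_exists_mul_eq_one O (hm i)
  have hp' : ∀ i, 1 + Z i ≠ 0 ∧ (1 + Z i)⁻¹ ∈ O := fun i => ne_zero_and_inv_mem_of_exists_mul_eq_one O (hp i)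
  have hY : ∀ i, (1 + Z i) / (1 - Z i) ∈ O := fun i => by
    rw [div_eq_mul_inv]; exact Subring.mul_mem _ (Subring.add_mem _ (Subring.one_mem _) (hZ i)) (hm' i).2
  have h2O : (2 : K) ∈ O := (by rw [show (2 : K) = 1 + 1 from by norm_num]; exact Subring.add_mem _ (Subring.one_mem O) (Subring.one_mem O))
  have hZmem : Z ∈ Submodule.span O (Set.range fun j : Fin n => fun i => Z i ^ (j : ℕ)) := by
    have h := eval_mem_span_pow O hZ (γ := Z) Polynomial.X
    simp only [Polynomial.map_X, Polynomial.eval_X] at h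
    exact h
  have hYmem : (fun i => (1 + Z i) / (1 - Z i)) ∈ Submodule.span O (Set.range fun j : Fin n => fun i => ((1 + Z i) / (1 - Z i)) ^ (j : ℕ)) := by
    have h := eval_mem_span_pow O hY (γ := fun i => (1 + Z i) / (1 - Z i)) Polynomial.X
    simp only [Polynomial.map_X, Polynomial.eval_X] at h
    exact h
  apply le_antisymm
  · -- `Z ∈ R_Y`: `Z = (Y − 1) · (Y + 1)⁻¹`, `Y + 1` a unit of `O` with inverse `(1 − Z)∕2`
    refine span_pow_le_span_pow_of_mem O hY ?_
    have h1 : (1 : Fin n → K) ∈ Submodule.span O (Set.range fun j : Fin n => fun i => ((1 + Z i) / (1 - Z i)) ^ (j : ℕ)) := one_mem_span_pow O hY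
    have hp1 : (fun i => (1 + Z i) / (1 - Z i) + 1) ∈ Submodule.span O (Set.range fun j : Fin n => fun i => ((1 + Z i) / (1 - Z i)) ^ (j : ℕ)) := by
      have : (fun i => (1 + Z i) / (1 - Z i) + 1) = (fun i => (1 + Z i) / (1 - Z i)) + 1 := rfl
      rw [this]; exact Submodule.add_mem _ hYmem h1
    have hm1 : (fun i => (1 + Z i) / (1 - Z i) - 1) ∈ Submodule.span O (Set.range fun j : Fin n => fun i => ((1 + Z i) / (1 - Z i)) ^ (j : ℕ)) := by
      have : (fun i => (1 + Z i) / (1 - Z i) - 1) = (fun i => (1 + Z i) / (1 - Z i)) - 1 := rfl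
      rw [this]; exact Submodule.sub_mem _ hYmem h1
    have hp1val : ∀ i, (1 + Z i) / (1 - Z i) + 1 = 2 * (1 - Z i)⁻¹ := fun i => by field_simp [(hm' i).1]; ring
    have hp1u : ∀ i, ∃ y ∈ O, y * ((1 + Z i) / (1 - Z i) + 1) = 1 := fun i =>
      ⟨(2 : K)⁻¹ * (1 - Z i), Subring.mul_mem _ h2 (Subring.sub_mem _ (Subring.one_mem _) (hZ i)), by rw [hp1val i]; field_simp [(hm' i).1, h20]⟩
    have hinv := inv_mem_span_pow O hY hp1 hp1u
    have hZeq : Z = (fun i => (1 + Z i) / (1 - Z i) - 1) * (fun i => (1 + Z i) / (1 - Z i) + 1)⁻¹ := by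
      funext i
      simp only [Pi.mul_apply, Pi.inv_apply]
      rw [hp1val i, mul_inv, inv_inv, div_sub_one (hm' i).1]
      field_simp [(hm' i).1, h20]
      ring
    have hmem := mul_mem_span_pow O hY hm1 hinv
    exact (congrArg (fun t : Fin n → K => t ∈ Submodule.span O (Set.range fun j : Fin n => fun i => ((1 + Z i) / (1 - Z i)) ^ (j : ℕ))) hZeq).mpr hmem
  · -- `Y ∈ R_Z`: `Y = (1 + Z)(1 − Z)⁻¹`
    refine span_pow_le_span_pow_of_mem O hZ ?_
    have h1 : (1 : Fin n → K) ∈ Submodule.span O (Set.range fun j : Fin n => fun i => Z i ^ (j : ℕ)) := one_mem_span_pow O hZ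
    have hpl : (fun i => 1 + Z i) ∈ Submodule.span O (Set.range fun j : Fin n => fun i => Z i ^ (j : ℕ)) := by
      have : (fun i => 1 + Z i) = 1 + Z := rfl
      rw [this]; exact Submodule.add_mem _ h1 hZmem
    have hmi : (fun i => 1 - Z i) ∈ Submodule.span O (Set.range fun j : Fin n => fun i => Z i ^ (j : ℕ)) := by
      have : (fun i => 1 - Z i) = 1 - Z := rfl
      rw [this]; exact Submodule.sub_mem _ h1 hZmem
    have hinv := inv_mem_span_pow O hZ hmi hm
    have hYeq : (fun i => (1 + Z i) / (1 - Z i)) = (fun i => 1 + Z i) * (fun i => 1 - Z i)⁻¹ := by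
      funext i; simp only [Pi.mul_apply, Pi.inv_apply, div_eq_mul_inv]
    rw [hYeq]
    exact mul_mem_span_pow O hZ hpl hinv

/-- **`Y⁻¹ ∈ R_Y`** (the Cayley transform is a UNIT of the order: `Y_i⁻¹ = (1 − Z_i)(1 + Z_i)⁻¹ ∈ O`). [cite: Weil1964, §29] -/
theorem cayley_inv_mem_span_pow {Z : Fin n → K} (hZ : ∀ i, Z i ∈ O)
    (hm : ∀ i, ∃ y ∈ O, y * (1 - Z i) = 1) (hp : ∀ i, ∃ y ∈ O, y * (1 + Z i) = 1) :
    (fun i => (1 + Z i) / (1 - Z i))⁻¹ ∈ Submodule.span O (Set.range fun j : Fin n => fun i => ((1 + Z i) / (1 - Z i)) ^ (j : ℕ)) := by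
  have hm' : ∀ i, 1 - Z i ≠ 0 ∧ (1 - Z i)⁻¹ ∈ O := fun i => ne_zero_and_inv_mem_of_exists_mul_eq_one O (hm i)
  have hp' : ∀ i, 1 + Z i ≠ 0 ∧ (1 + Z i)⁻¹ ∈ O := fun i => ne_zero_and_inv_mem_of_exists_mul_eq_one O (hp i)
  have hY : ∀ i, (1 + Z i) / (1 - Z i) ∈ O := fun i => by
    rw [div_eq_mul_inv]; exact Subring.mul_mem _ (Subring.add_mem _ (Subring.one_mem _) (hZ i)) (hm' i).2
  have hYmem : (fun i => (1 + Z i) / (1 - Z i)) ∈ Submodule.span O (Set.range fun j : Fin n => fun i => ((1 + Z i) / (1 - Z i)) ^ (j : ℕ)) := by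
    have h := eval_mem_span_pow O hY (γ := fun i => (1 + Z i) / (1 - Z i)) Polynomial.X
    simp only [Polynomial.map_X, Polynomial.eval_X] at h
    exact h
  refine inv_mem_span_pow O hY hYmem fun i => ⟨(1 - Z i) * (1 + Z i)⁻¹, Subring.mul_mem _ (Subring.sub_mem _ (Subring.one_mem _) (hZ i)) (hp' i).2, ?_⟩
  field_simp [(hm' i).1, (hp' i).1]

/-! ## §3 Unitarity: the Cayley parameter is skew and `Y` has norm one -/

/-- **`σ z = −z`** for `z = (γ−1)(γ+1)⁻¹` and `σ(γ)γ = 1`. [cite: Weil1964, §29] -/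
theorem map_cayleyParam_eq_neg (σ : K →+* K) {g : K} (hσg : σ g * g = 1) (hg1 : g + 1 ≠ 0) :
    σ ((g - 1) / (g + 1)) = -((g - 1) / (g + 1)) := by
  have hg0 : g ≠ 0 := fun h0 => by rw [h0, mul_zero] at hσg; exact zero_ne_one hσg
  have hσ : σ g = g⁻¹ := eq_inv_of_mul_eq_one_left hσg
  have hσ1 : σ g + 1 ≠ 0 := by
    rw [hσ]; intro h0
    apply hg1
    have : g⁻¹ = -1 := eq_neg_of_add_eq_zero_left h0
    have hg : g = -1 := by rw [← inv_inv g, this]; norm_num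
    rw [hg]; norm_num
  have h1g : 1 + g ≠ 0 := by rwa [add_comm]
  rw [map_div₀, map_sub, map_add, map_one, hσ]
  field_simp
  ring

/-- **`σ(Y)·Y = 1`** for `Y = (1 + Z)(1 − Z)⁻¹` with `σ Z = −Z` (`Z = c⁻¹z`, `σ c = c`): the Cayley transform of a skew element is unitary. [cite: Weil1964, §29] -/
theorem map_cayley_mul_cayley (σ : K →+* K) {Z : K} (hσZ : σ Z = -Z) (hm : 1 - Z ≠ 0) (hp : 1 + Z ≠ 0) :
    σ ((1 + Z) / (1 - Z)) * ((1 + Z) / (1 - Z)) = 1 := by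
  rw [map_div₀, map_add, map_sub, map_one, hσZ, sub_neg_eq_add, ← sub_eq_add_neg]
  field_simp

/-- The shifted Cayley parameter of a norm-one eigenvalue is skew: `σ(c⁻¹ z_i) = −c⁻¹ z_i` (`σ c = c`). [cite: Weil1964, §29] -/
theorem map_shift_cayleyParam_eq_neg (σ : K →+* K) {c : K} (hσc : σ c = c) {g : K} (hσg : σ g * g = 1) (hg1 : g + 1 ≠ 0) :
    σ (c⁻¹ * ((g - 1) / (g + 1))) = -(c⁻¹ * ((g - 1) / (g + 1))) := by
  rw [map_mul, map_inv₀, hσc, map_cayleyParam_eq_neg σ hσg hg1, mul_neg]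

/-! ## §4 Differences: `Y_i − Y_j` versus `γ_i − γ_j` -/

/-- `Y_i − Y_j = 2(Z_i − Z_j)∕((1 − Z_i)(1 − Z_j))`. [cite: SerreLocalFields1979, Ch. V §3] -/
theorem cayley_sub_cayley {Zi Zj : K} (hi : 1 - Zi ≠ 0) (hj : 1 - Zj ≠ 0) :
    (1 + Zi) / (1 - Zi) - (1 + Zj) / (1 - Zj) = 2 * (Zi - Zj) / ((1 - Zi) * (1 - Zj)) := by
  field_simp
  ring

/-- `z_i − z_j = 2(γ_i − γ_j)∕((γ_i + 1)(γ_j + 1))`. [cite: SerreLocalFields1979, Ch. V §3] -/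
theorem cayleyParam_sub_cayleyParam {gi gj : K} (hi : gi + 1 ≠ 0) (hj : gj + 1 ≠ 0) :
    (gi - 1) / (gi + 1) - (gj - 1) / (gj + 1) = 2 * (gi - gj) / ((gi + 1) * (gj + 1)) := by
  field_simp
  ring

end Algebra

section Valuation

open scoped ValuativeRel
open ValuativeRel

variable {F : Type*} [Field F] [ValuativeRel F]

/-- **`|Y_i − Y_j| = |γ_i − γ_j| ∕ |c|`**: the root valuations of the Cayley shift are those of `γ` divided by `|c|` — «every root valuation lowered by `j`» for `c = ϖ^j` —
when `2`, `γ_i + 1`, `γ_j + 1`, `1 − Z_i`, `1 − Z_j` are units. [cite: SerreLocalFields1979, Ch. V §3] [cite: Rogawski1990, §4.9 p. 54] -/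
theorem valuation_cayley_sub_cayley {c gi gj : F} (h2 : valuation F (2 : F) = 1)
    (hgi : valuation F (gi + 1) = 1) (hgj : valuation F (gj + 1) = 1)
    (hZi : valuation F (1 - c⁻¹ * ((gi - 1) / (gi + 1))) = 1) (hZj : valuation F (1 - c⁻¹ * ((gj - 1) / (gj + 1))) = 1) :
    valuation F ((1 + c⁻¹ * ((gi - 1) / (gi + 1))) / (1 - c⁻¹ * ((gi - 1) / (gi + 1))) -
        (1 + c⁻¹ * ((gj - 1) / (gj + 1))) / (1 - c⁻¹ * ((gj - 1) / (gj + 1)))) =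
      valuation F (gi - gj) / valuation F c := by
  have hi1 : gi + 1 ≠ 0 := fun h0 => by rw [h0, map_zero] at hgi; exact zero_ne_one hgi
  have hj1 : gj + 1 ≠ 0 := fun h0 => by rw [h0, map_zero] at hgj; exact zero_ne_one hgj
  have hmi : 1 - c⁻¹ * ((gi - 1) / (gi + 1)) ≠ 0 := fun h0 => by rw [h0, map_zero] at hZi; exact zero_ne_one hZi
  have hmj : 1 - c⁻¹ * ((gj - 1) / (gj + 1)) ≠ 0 := fun h0 => by rw [h0, map_zero] at hZj; exact zero_ne_one hZj
  rw [cayley_sub_cayley hmi hmj, ← mul_sub, cayleyParam_sub_cayleyParam hi1 hj1]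
  rw [map_div₀, map_mul, map_mul, map_mul, map_div₀, map_mul, map_mul, map_inv₀, h2, hgi, hgj, hZi, hZj]
  simp [div_eq_mul_inv, mul_comm]

end Valuation

/-! ## §5 The matrix bridge: `y ∈ R_x ⇒ P·diag(y)·P⁻¹ ∈ Algebra.adjoin O {P·diag(x)·P⁻¹}` -/

section Bridge

variable {K : Type*} [Field K] {n : ℕ} (O : Subring K)

/-- `diagonal` of an `O`-combination of power vectors is the same combination of powers of the diagonal matrix, conjugated: `P·diag(Σ c_j x^j)·P⁻¹ = Σ c_j (P·diag(x)·P⁻¹)^j`.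
[cite: SerreLocalFields1979, Ch. III §6] -/
theorem conj_diagonal_sum_smul_pow (P : GL (Fin n) K) (x : Fin n → K) (cf : Fin n → O) :
    (P : Matrix (Fin n) (Fin n) K) * diagonal (∑ j : Fin n, cf j • fun i => x i ^ (j : ℕ)) * ((P⁻¹ : GL (Fin n) K) : Matrix (Fin n) (Fin n) K) =
      ∑ j : Fin n, cf j • ((P : Matrix (Fin n) (Fin n) K) * diagonal x * ((P⁻¹ : GL (Fin n) K) : Matrix (Fin n) (Fin n) K)) ^ (j : ℕ) := by
  have hdiag : diagonal (∑ j : Fin n, cf j • fun i => x i ^ (j : ℕ)) = ∑ j : Fin n, cf j • diagonal (x ^ (j : ℕ)) := by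
    ext a b
    simp only [diagonal_apply, Matrix.sum_apply, Matrix.smul_apply, Finset.sum_apply, Pi.smul_apply, Pi.pow_apply]
    split_ifs with h
    · rfl
    · simp
  rw [hdiag, Finset.mul_sum, Finset.sum_mul]
  refine Finset.sum_congr rfl fun j _ => ?_
  rw [conj_diagonal_pow, Matrix.mul_smul, Matrix.smul_mul]

/-- **THE MATRIX BRIDGE**: if `y ∈ span_O {x^j}` (eigen-coordinates) then `P·diag(y)·P⁻¹ ∈ Algebra.adjoin O {P·diag(x)·P⁻¹}` — with §1–§2: `Y^{±1} ∈ O[X]` and `X ∈ O[Y]` as MATRICES,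
the hypotheses of F0P2-p01's «ORDER-STABILITY». [cite: SerreLocalFields1979, Ch. III §6] -/
theorem conj_diagonal_mem_adjoin_of_mem_span_pow (P : GL (Fin n) K) {x y : Fin n → K}
    (hy : y ∈ Submodule.span O (Set.range fun j : Fin n => fun i => x i ^ (j : ℕ))) :
    (P : Matrix (Fin n) (Fin n) K) * diagonal y * ((P⁻¹ : GL (Fin n) K) : Matrix (Fin n) (Fin n) K) ∈
      Algebra.adjoin O ({(P : Matrix (Fin n) (Fin n) K) * diagonal x * ((P⁻¹ : GL (Fin n) K) : Matrix (Fin n) (Fin n) K)} : Set (Matrix (Fin n) (Fin n) K)) := by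
  obtain ⟨cf, hcf⟩ := (Submodule.mem_span_range_iff_exists_fun O).1 hy
  rw [← hcf, conj_diagonal_sum_smul_pow]
  refine Subalgebra.sum_mem _ fun j _ => Subalgebra.smul_mem _ (Subalgebra.pow_mem _ (Algebra.self_mem_adjoin_singleton O _) _) _

end Bridge

end Literature.NumberTheory.Automorphic
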